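/-
Literature/NumberTheory/ComplexMultiplication/DegenerateCMTypesAbelianKernelsExponentFourSquarefree.lean — pub-hodgecm2 (COR-CM), KEPT Literature
lane lit-deligne-3 gen 65, file F65h.  THEOREMS ONLY (no `def`, no named fact, no `sorry`, no instance, no notation; D-0026 net debt 0).
HC_CM is NOT proved.
-/
import Literature.NumberTheory.ComplexMultiplication.DegenerateCMTypesAbelianKernelsExponentTwiceSquarefree
import Literature.NumberTheory.ComplexMultiplication.DegenerateCMTypesAbelianKernelsIndexFourSquarefree
import Literature.NumberTheory.ComplexMultiplication.DegenerateCMTypesAbelianKernelsIndexFour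
import HarnessLib

/-!
# The rank of a CM type by kernels in EXPONENT `4m`, `m` ODD SQUAREFREE (any finite abelian group, any number of primes):
# `rank + #B₂ + 2·#B₄ + Σ_{∅ ≠ D ⊆ primes(m)} (φ(2Π_D q)·#B_{2,D} + φ(4Π_D q)·#B_{4,D}) = |G|/2 + 1`, every index class decided

Topic `Literature/NumberTheory/ComplexMultiplication` (namespace `Literature.NumberTheory.ComplexMultiplication.CyclicCMType.AbelianKernels`); cell
`pub-hodgecm2` (COR-CM), KEPT Literature lane `lit-deligne-3` gen 65, file F65h — the GROUP-LEVEL synthesis of the lane's SQUAREFREE-ODD-PART programme for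
`2`-part of exponent `4`: Kubota's defect regrouped by kernels, the index classes `2Π_D q` and `4Π_D q` indexed by the sets `D` of prime divisors of `m`, the
former decided by Dodson ∕ the lane's F65e, the latter (cyclic quotient) by Yanai's index-`4` criterion ∕ the lane's F65f.  The cases `m = p`, `pq` are the
tree's `ExponentFourTimesPrime` (F64b-2 §1) and `ExponentFourTimesTwoOddPrimes` (F65c §1); the exponent-`2m` sibling is F65g.  KERNEL ONLY: theorems; no
`def`, no named fact, no instance, no notation (D-0014 ∕ D-0026 net debt `0`).  HC_CM is NOT proved here or anywhere in the lane.

## Mathematics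

Kubota's count [Kubota1965, §4 Lemma 2] regrouped by kernels (White; tree `typeRank_add_sum_totient_eq`): `rank(T) + Σ_H φ([G:H]) = |G|/2 + 1` over the
admissible kernels `H ∌ ρ`, `G/H` cyclic, whose characters vanish on `T`.  If `g^{4m} = 1` on `G` (`m` odd squarefree) an admissible kernel has index `2d` or
`4d` with `d | m`: `[G:H] = 2Π_{q∈D} q` with `D = primeFactors([G:H]/2)` when `4 ∤ [G:H]`, and `[G:H] = 4Π_{q∈D} q` with `D = primeFactors([G:H]/4)` when
`4 | [G:H]` (**`index_eq_prod_primeFactors_of_exponent_four_mul`**).  Subgroups `H ∌ ρ` of index `2Π_D q` have cyclic quotient automatically (squarefree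
order); for index `4Π_D q` cyclicity is a genuine clause (quotient `ℤ/2 × ℤ/2Π_D q` carries no character of that kernel).  The classes are DECIDED: index `2`
by even splitting ([Dodson1984] §3.1.1), index `4` (cyclic) by `2·#(T ∩ gH) = |H|` for all `g` ([Yanai2015IndexDegeneracy]; tree `…iff_of_index_four`), index
`2Π_D q` and `4Π_D q` (`D ≠ ∅`) by the vanishing of the `|D|`-th mixed differences `Σ_{ε∈{0,1}^D} (−1)^{|ε|} #(T ∩ g·Π_{ε_q=1} x_q·H) = 0` (F65e, F65f;
[Hazama2003CyclicCM] Lemma 4.6.1 mechanism, [LamLeung2000] Thm. 2.2).  Hence, EXACTLY (**`typeRank_add_card_kernels_eq_of_exponent_four_mul_squarefree`**),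

  `rank(T) + #B₂ + 2·#B₄ + Σ_{∅ ≠ D ⊆ primeFactors(m)} (φ(2Π_D q)·#B_{2,D} + φ(4Π_D q)·#B_{4,D}) = |G|/2 + 1`

(`φ(4d) = 2φ(2d) = 2Π_{q∈D}(q − 1)`).

* §0 private helpers (suffix `_ef`) and **`index_eq_prod_primeFactors_of_exponent_four_mul`**.
* §1 **`typeRank_add_card_kernels_eq_of_exponent_four_mul_squarefree`**: the admissible kernels are split by `4 ∣ [G:H]` (`Finset.sum_filter_add_sum_filter_not`)
  and each half partitioned by its class map (`Finset.sum_fiberwise_of_maps_to`), each fibre identified with `B₂ ∕ B_{2,D}` resp. `B₄ ∕ B_{4,D}` by the tree's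
  index-`2` ∕ index-`4` decisions and the lane's F65e ∕ F65f `_fintype` forms on `ι = ↥D`; the final bookkeeping by `omega` on the collected identities.
* §1 (append, same gen) **`typeRank_eq_iff_of_exponent_four_mul_squarefree`**: NONDEGENERATE ⟺ `B₂ = B₄ = ∅` and `B_{2,D} = B_{4,D} = ∅` for every nonempty
  `D` (all coefficients `φ(2Π_D q)`, `φ(4Π_D q)` are positive).

PRESEARCH (lane rule): as for F65g — not found as printed for `m` with `≥ 3` prime factors (corpus hybrid + galaxy, earlier lane queries: 0 relevant); the
ingredients (Kubota, White, Dodson, Yanai, Hazama, Lam–Leung) are cited at each statement; recorded as the lane's own elementary theorem.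

HONEST REGISTER.  Unconditional and elementary given the tree.  `2`-part of exponent exactly `≤ 4`; nothing is claimed about the Hodge classes of degenerate
types.  HC_CM is NOT proved and not used.

## References

* [Kubota1965] T. Kubota, *On the field extension by complex multiplication*, Trans. AMS 118 (1965), §4 Lemma 2.
* [White1993SporadicCycles] S. P. White, *Sporadic cycles on CM abelian varieties*, Compositio Math. 88 (1993), §4, proof of Lemma 3 (p. 131).
* [Dodson1984] B. Dodson, *The structure of Galois groups of CM-fields*, Trans. AMS 283 (1984), §3.1.1 Theorem.
* [Yanai2015IndexDegeneracy] H. Yanai, *On the index of degeneracy of a CM-type*, Thm. 4.1 (proof, p. 818).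
* [Hazama2003CyclicCM] F. Hazama, *Hodge cycles on abelian varieties with complex multiplication by cyclic CM-fields*, J. Math. Sci. Univ. Tokyo 10
  (2003): Prop. 4.3, Lemma 4.6.1, Thm. 4.8.
* [LamLeung2000] T. Y. Lam, K. H. Leung, *On vanishing sums of roots of unity*, J. Algebra 224 (2000), Thm. 2.2 (via the lane's F65d–F65f).

## Provenance

Cell `pub-hodgecm2` (COR-CM), KEPT Literature lane `lit-deligne-3` gen 65 (claim ABELIAN-EXPONENT-4SQUAREFREE-RANK; count-neutral, own lane), file F65h;
neighbours cited by name, nothing restated: `DegenerateCMTypesAbelianKernels` (`typeRank_add_sum_totient_eq`, `…iff_of_index_two`),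
`DegenerateCMTypesAbelianKernelsIndexFour` (`…iff_of_index_four`), `DegenerateCMTypesAbelianKernelsExponentTwiceSquarefree` (F65g, imported for the cone),
`DegenerateCMTypesAbelianKernelsIndexTwiceSquarefree` ∕ `…IndexFourSquarefree` (F65e ∕ F65f `_fintype`).  Theorems only; net Literature debt 0.
-/

noncomputable section

open scoped BigOperators Classical

namespace Literature.NumberTheory.ComplexMultiplication

namespace CyclicCMType

namespace AbelianKernels

variable {G : Type*} [CommGroup G] [Fintype G] [DecidableEq G] {ρ : G} {T : Finset G} {m : ℕ}

/-! ## §0 Helpers -/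

section Helpers

/-- A finite commutative group of squarefree order is cyclic. [folklore] -/
private theorem isCyclic_of_squarefree_card_ef {K : Type*} [CommGroup K] [Finite K] (hK : Squarefree (Nat.card K)) : IsCyclic K := by
  apply IsCyclic.of_exponent_eq_card
  apply Nat.dvd_antisymm Group.exponent_dvd_nat_card
  rw [← Nat.prod_primeFactors_of_squarefree hK]
  refine Finset.prod_primes_dvd _ (fun q hq => Nat.prime_iff.mp (Nat.prime_of_mem_primeFactors hq)) fun q hq => ?_
  haveI : Fact q.Prime := ⟨Nat.prime_of_mem_primeFactors hq⟩
  obtain ⟨g, hg⟩ := exists_prime_orderOf_dvd_card' (G := K) q (Nat.dvd_of_mem_primeFactors hq)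
  rw [← hg]
  exact Monoid.order_dvd_exponent g

omit [Fintype G] [DecidableEq G] in
/-- The index of an admissible kernel divides the exponent `4m` and is even. [folklore] -/
private theorem index_dvd_and_two_dvd_ef (hexp : ∀ g : G, g ^ (4 * m) = 1) {H : Subgroup G} (hρH : ρ ∉ H) (hρ2 : ρ * ρ = 1)
    (hcyc : IsCyclic (G ⧸ H)) : H.index ∣ 4 * m ∧ 2 ∣ H.index := by
  haveI := hcyc
  refine ⟨?_, ?_⟩
  · rw [Subgroup.index_eq_card, ← IsCyclic.exponent_eq_card]
    exact Monoid.exponent_dvd_of_forall_pow_eq_one fun x => QuotientGroup.induction_on x fun g => by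
      rw [← QuotientGroup.mk_pow, hexp, QuotientGroup.mk_one]
  · have hρ1 : (ρ : G ⧸ H) ≠ 1 := fun h => hρH ((QuotientGroup.eq_one_iff ρ).1 h)
    have hord : orderOf (ρ : G ⧸ H) = 2 := by
      haveI : Fact (Nat.Prime 2) := ⟨Nat.prime_two⟩
      refine orderOf_eq_prime ?_ hρ1
      rw [pow_two, ← QuotientGroup.mk_mul, hρ2, QuotientGroup.mk_one]
    rw [Subgroup.index_eq_card, ← hord]
    exact orderOf_dvd_natCard _

omit [Fintype G] [DecidableEq G] in
/-- **The admissible kernels in exponent `4m`, `m` odd squarefree**: a subgroup `H ∌ ρ` with cyclic quotient has index `2Π_{q∈D} q` (if `4 ∤ [G:H]`,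
`D = primeFactors([G:H]/2)`) or `4Π_{q∈D} q` (if `4 ∣ [G:H]`, `D = primeFactors([G:H]/4)`), `D ⊆ primeFactors(m)`. [cite: Kubota1965, §4 Lemma 2]
[cite: White1993SporadicCycles, §4, proof of Lemma 3 (p. 131)] -/
theorem index_eq_prod_primeFactors_of_exponent_four_mul (hm : Squarefree m) (hexp : ∀ g : G, g ^ (4 * m) = 1)
    {H : Subgroup G} (hρH : ρ ∉ H) (hρ2 : ρ * ρ = 1) (hcyc : IsCyclic (G ⧸ H)) :
    (¬ 4 ∣ H.index → (H.index / 2).primeFactors ⊆ m.primeFactors ∧ H.index = 2 * ∏ q ∈ (H.index / 2).primeFactors, q) ∧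
      (4 ∣ H.index → (H.index / 4).primeFactors ⊆ m.primeFactors ∧ H.index = 4 * ∏ q ∈ (H.index / 4).primeFactors, q) := by
  obtain ⟨hdvd, h2⟩ := index_dvd_and_two_dvd_ef hexp hρH hρ2 hcyc
  have hm0 : m ≠ 0 := hm.ne_zero
  refine ⟨fun h4 => ?_, fun h4 => ?_⟩
  · have hidx : H.index = 2 * (H.index / 2) := (Nat.mul_div_cancel' h2).symm
    have hd2m : H.index / 2 ∣ 2 * m := by
      apply Nat.dvd_of_mul_dvd_mul_left two_pos
      rw [← hidx, show 2 * (2 * m) = 4 * m by ring]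
      exact hdvd
    have hdodd : Nat.Coprime (H.index / 2) 2 := by
      rw [Nat.coprime_comm, Nat.Prime.coprime_iff_not_dvd Nat.prime_two]
      intro h22
      apply h4
      rw [hidx]
      exact Nat.mul_dvd_mul_left 2 h22 |>.trans (by norm_num)
    have hd : H.index / 2 ∣ m := hdodd.dvd_of_dvd_mul_left hd2m
    refine ⟨Nat.primeFactors_mono hd hm0, ?_⟩
    rw [Nat.prod_primeFactors_of_squarefree (hm.squarefree_of_dvd hd)]
    exact hidx
  · have hidx : H.index = 4 * (H.index / 4) := (Nat.mul_div_cancel' h4).symm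
    have hd : H.index / 4 ∣ m := Nat.dvd_of_mul_dvd_mul_left four_pos (hidx ▸ hdvd)
    refine ⟨Nat.primeFactors_mono hd hm0, ?_⟩
    rw [Nat.prod_primeFactors_of_squarefree (hm.squarefree_of_dvd hd)]
    exact hidx

end Helpers

/-! ## §1 The rank of a CM type in exponent `4m` (`m` odd squarefree): Kubota's defect by kernels, every index class decided -/

section ExponentFourSquarefree

/-- **THE RANK OF A CM TYPE BY KERNELS, EXPONENT `4m` WITH `m` ODD SQUAREFREE** (any finite commutative group `G` with `g^{4m} = 1`, conjugation
`ρ`, CM type `T`):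

  `rank(T) + #B₂ + 2·#B₄ + Σ_{∅ ≠ D ⊆ primes(m)} (φ(2Π_D q)·#B_{2,D} + φ(4Π_D q)·#B_{4,D}) = |G|/2 + 1`,

with `B₂` (index `2`, even splitting, Dodson), `B₄` (index `4`, CYCLIC quotient, every coset met in `|H|/2` elements — Yanai's criterion, tree
`…iff_of_index_four`), `B_{2,D}` (index `2Π_{q∈D} q`, vanishing `|D|`-th mixed differences of the coset counts — the lane's F65e) and `B_{4,D}` (index
`4Π_{q∈D} q`, CYCLIC quotient, the same mixed-difference condition — the lane's F65f).  Kubota's defect over the admissible kernels: each has index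
`2Π_D q` or `4Π_D q` (`index_eq_prod_primeFactors_of_exponent_four_mul`); the index-`2Π_D q` subgroups `H ∌ ρ` are automatically admissible (squarefree
order), the index-`4Π_D q` ones carry the cyclicity clause.  The cases `m = p`, `pq` are the tree's `ExponentFourTimesPrime` (F64b-2 §1) and
`ExponentFourTimesTwoOddPrimes` (F65c §1). [cite: Kubota1965, §4 Lemma 2] [cite: White1993SporadicCycles, §4, proof of Lemma 3 (p. 131)]
[cite: Hazama2003CyclicCM, Prop. 4.3, Lemma 4.6.1 and Thm. 4.8] [cite: Dodson1984, §3.1.1 Theorem] [cite: Yanai2015IndexDegeneracy, Thm. 4.1]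
[cite: LamLeung2000, Thm. 2.2] -/
theorem typeRank_add_card_kernels_eq_of_exponent_four_mul_squarefree (hm : Squarefree m) (hodd : ¬ 2 ∣ m)
    (h : IsCMTypeWith ρ (T : Set G)) (hexp : ∀ g : G, g ^ (4 * m) = 1) :
    typeRank G (T : Set G) +
      ((Finset.univ : Finset (Subgroup G)).filter fun H => ρ ∉ H ∧ H.index = 2 ∧
        (T.filter fun s => s ∈ H).card = (T.filter fun s => s ∉ H).card).card +
      2 * ((Finset.univ : Finset (Subgroup G)).filter fun H : Subgroup G => ρ ∉ H ∧ H.index = 4 ∧ IsCyclic (G ⧸ H) ∧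
        ∀ g : G, 2 * ((T.filter fun s => g⁻¹ * s ∈ H).card) = Nat.card H).card +
      ∑ D ∈ m.primeFactors.powerset.filter (fun D => D.Nonempty),
        ((2 * ∏ q ∈ D, q).totient *
          ((Finset.univ : Finset (Subgroup G)).filter fun H => ρ ∉ H ∧ H.index = 2 * ∏ q ∈ D, q ∧
            ∀ (g : G) (x : D → G), (∀ q : D, x q ^ (q : ℕ) ∈ H) →
              ∑ ε : D → Bool, (∏ q, (if ε q then (-1 : ℤ) else 1)) *
                ((T.filter fun s => (g * ∏ q, (if ε q then x q else 1))⁻¹ * s ∈ H).card : ℤ) = 0).card +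
        (4 * ∏ q ∈ D, q).totient *
          ((Finset.univ : Finset (Subgroup G)).filter fun H => ρ ∉ H ∧ H.index = 4 * ∏ q ∈ D, q ∧ IsCyclic (G ⧸ H) ∧
            ∀ (g : G) (x : D → G), (∀ q : D, x q ^ (q : ℕ) ∈ H) →
              ∑ ε : D → Bool, (∏ q, (if ε q then (-1 : ℤ) else 1)) *
                ((T.filter fun s => (g * ∏ q, (if ε q then x q else 1))⁻¹ * s ∈ H).card : ℤ) = 0).card) =
      Fintype.card G / 2 + 1 := by
  have hρ2 : ρ * ρ = 1 := by simpa [smul_eq_mul] using h.invol (1 : G)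
  have key := typeRank_add_sum_totient_eq h
  have hm0 : m ≠ 0 := hm.ne_zero
  have h2m : Squarefree (2 * m) :=
    Nat.squarefree_mul_iff.2 ⟨(Nat.Prime.coprime_iff_not_dvd Nat.prime_two).2 hodd, Nat.prime_two.prime.squarefree, hm⟩
  set A := (Finset.univ : Finset (Subgroup G)).filter (fun H => ρ ∉ H ∧ IsCyclic (G ⧸ H) ∧
    ∀ χ : AddChar (Additive G) ℂ, (∀ g : G, χ (Additive.ofMul g) = 1 ↔ g ∈ H) →
      ∑ s ∈ T, χ (Additive.ofMul s) = 0) with hA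
  set B₂ := (Finset.univ : Finset (Subgroup G)).filter (fun H => ρ ∉ H ∧ H.index = 2 ∧
    (T.filter fun s => s ∈ H).card = (T.filter fun s => s ∉ H).card) with hB₂
  set B₄ := ((Finset.univ : Finset (Subgroup G)).filter fun H : Subgroup G => ρ ∉ H ∧ H.index = 4 ∧ IsCyclic (G ⧸ H) ∧
    ∀ g : G, 2 * ((T.filter fun s => g⁻¹ * s ∈ H).card) = Nat.card H) with hB₄
  -- the two class maps
  set cls₂ : Subgroup G → Finset ℕ := fun H => (H.index / 2).primeFactors with hcls₂
  set cls₄ : Subgroup G → Finset ℕ := fun H => (H.index / 4).primeFactors with hcls₄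
  -- facts about a set `D` of primes of `m`
  have hDprime : ∀ D ∈ m.primeFactors.powerset, ∀ q ∈ D, q.Prime := fun D hD q hq =>
    Nat.prime_of_mem_primeFactors (Finset.mem_powerset.1 hD hq)
  have hDdvd : ∀ D ∈ m.primeFactors.powerset, (∏ q ∈ D, q) ∣ m := fun D hD =>
    (Finset.prod_dvd_prod_of_subset _ _ _ (Finset.mem_powerset.1 hD)).trans (Nat.prod_primeFactors_of_squarefree hm).dvd
  have hDodd : ∀ D ∈ m.primeFactors.powerset, ¬ 2 ∣ ∏ q ∈ D, q := fun D hD h2 => hodd (h2.trans (hDdvd D hD))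
  have hnot4 : ∀ D ∈ m.primeFactors.powerset, ¬ 4 ∣ 2 * ∏ q ∈ D, q := by
    intro D hD h4
    apply hDodd D hD
    have : 2 * 2 ∣ 2 * ∏ q ∈ D, q := h4
    exact Nat.dvd_of_mul_dvd_mul_left two_pos this
  have hcls₂D : ∀ D ∈ m.primeFactors.powerset, ∀ H : Subgroup G, H.index = 2 * ∏ q ∈ D, q → cls₂ H = D := by
    intro D hD H hidx
    rw [hcls₂]
    dsimp only
    rw [hidx, Nat.mul_div_cancel_left _ two_pos, Nat.primeFactors_prod (hDprime D hD)]
  have hcls₄D : ∀ D ∈ m.primeFactors.powerset, ∀ H : Subgroup G, H.index = 4 * ∏ q ∈ D, q → cls₄ H = D := by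
    intro D hD H hidx
    rw [hcls₄]
    dsimp only
    rw [hidx, Nat.mul_div_cancel_left _ four_pos, Nat.primeFactors_prod (hDprime D hD)]
  -- the two halves of the admissible kernels
  have hmaps₂ : ∀ H ∈ A.filter (fun H => ¬ 4 ∣ H.index), cls₂ H ∈ m.primeFactors.powerset := by
    intro H hH
    rw [Finset.mem_filter, hA, Finset.mem_filter] at hH
    exact Finset.mem_powerset.2 ((index_eq_prod_primeFactors_of_exponent_four_mul hm hexp hH.1.2.1 hρ2 hH.1.2.2.1).1 hH.2).1
  have hmaps₄ : ∀ H ∈ A.filter (fun H => 4 ∣ H.index), cls₄ H ∈ m.primeFactors.powerset := by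
    intro H hH
    rw [Finset.mem_filter, hA, Finset.mem_filter] at hH
    exact Finset.mem_powerset.2 ((index_eq_prod_primeFactors_of_exponent_four_mul hm hexp hH.1.2.1 hρ2 hH.1.2.2.1).2 hH.2).1
  have hidx₂ : ∀ H ∈ A.filter (fun H => ¬ 4 ∣ H.index), H.index = 2 * ∏ q ∈ cls₂ H, q := by
    intro H hH
    rw [Finset.mem_filter, hA, Finset.mem_filter] at hH
    exact ((index_eq_prod_primeFactors_of_exponent_four_mul hm hexp hH.1.2.1 hρ2 hH.1.2.2.1).1 hH.2).2
  have hidx₄ : ∀ H ∈ A.filter (fun H => 4 ∣ H.index), H.index = 4 * ∏ q ∈ cls₄ H, q := by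
    intro H hH
    rw [Finset.mem_filter, hA, Finset.mem_filter] at hH
    exact ((index_eq_prod_primeFactors_of_exponent_four_mul hm hexp hH.1.2.1 hρ2 hH.1.2.2.1).2 hH.2).2
  -- subgroups `H ∌ ρ` of index `2Π_D q` have cyclic quotient
  have hcycOf : ∀ D ∈ m.primeFactors.powerset, ∀ H : Subgroup G, H.index = 2 * ∏ q ∈ D, q → IsCyclic (G ⧸ H) := by
    intro D hD H hidx
    apply isCyclic_of_squarefree_card_ef
    rw [← Subgroup.index_eq_card, hidx]
    exact h2m.squarefree_of_dvd (Nat.mul_dvd_mul_left 2 (hDdvd D hD))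
  -- §A the fibres of the `2Π_D` half
  have hfib₂0 : (A.filter (fun H => ¬ 4 ∣ H.index)).filter (fun H => cls₂ H = ∅) = B₂ := by
    rw [hA, hB₂, Finset.filter_filter, Finset.filter_filter]
    refine Finset.filter_congr fun H _ => ?_
    constructor
    · rintro ⟨⟨hρH, hcyc, hchar⟩, h4, hc⟩
      have hidx : H.index = 2 := by
        have := ((index_eq_prod_primeFactors_of_exponent_four_mul hm hexp hρH hρ2 hcyc).1 h4).2
        rw [show (H.index / 2).primeFactors = ∅ from hc, Finset.prod_empty, mul_one] at this
        exact this
      exact ⟨hρH, hidx, (forall_sum_char_eq_zero_iff_of_index_two hρ2 hρH hidx T).1 hchar⟩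
    · rintro ⟨hρH, hidx, hsplit⟩
      have hidx' : H.index = 2 * ∏ q ∈ (∅ : Finset ℕ), q := by rw [Finset.prod_empty, mul_one]; exact hidx
      exact ⟨⟨hρH, hcycOf ∅ (Finset.empty_mem_powerset _) H hidx',
        (forall_sum_char_eq_zero_iff_of_index_two hρ2 hρH hidx T).2 hsplit⟩, by rw [hidx']; exact hnot4 ∅ (Finset.empty_mem_powerset _),
        hcls₂D ∅ (Finset.empty_mem_powerset _) H hidx'⟩
  have hfib₂D : ∀ D ∈ m.primeFactors.powerset, D.Nonempty →
      (A.filter (fun H => ¬ 4 ∣ H.index)).filter (fun H => cls₂ H = D) =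
        (Finset.univ : Finset (Subgroup G)).filter fun H => ρ ∉ H ∧ H.index = 2 * ∏ q ∈ D, q ∧
          ∀ (g : G) (x : D → G), (∀ q : D, x q ^ (q : ℕ) ∈ H) →
            ∑ ε : D → Bool, (∏ q, (if ε q then (-1 : ℤ) else 1)) *
              ((T.filter fun s => (g * ∏ q, (if ε q then x q else 1))⁻¹ * s ∈ H).card : ℤ) = 0 := by
    intro D hD hne
    have hne' : Nonempty D := hne.coe_sort
    have hpD : ∀ q : D, ((q : ℕ)).Prime := fun q => hDprime D hD q q.2
    have hoddD : ∀ q : D, (q : ℕ) ≠ 2 := fun q h2 => hodd (by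
      have := Nat.dvd_of_mem_primeFactors (Finset.mem_powerset.1 hD q.2)
      rwa [h2] at this)
    have hinjD : Function.Injective (fun q : D => (q : ℕ)) := Subtype.val_injective
    have hprodD : ∀ H : Subgroup G, H.index = 2 * ∏ q ∈ D, q → H.index = 2 * ∏ q : D, (q : ℕ) := fun H hidx => by
      rw [hidx, Finset.prod_coe_sort D (fun q => q)]
    rw [hA, Finset.filter_filter, Finset.filter_filter]
    refine Finset.filter_congr fun H _ => ?_
    constructor
    · rintro ⟨⟨hρH, hcyc, hchar⟩, h4, hc⟩
      have hidx : H.index = 2 * ∏ q ∈ D, q := by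
        rw [← hc]; exact ((index_eq_prod_primeFactors_of_exponent_four_mul hm hexp hρH hρ2 hcyc).1 h4).2
      exact ⟨hρH, hidx, (forall_sum_char_eq_zero_iff_alternatingSum_of_index_two_mul_squarefree_fintype hne' hpD hinjD hoddD
        h hρH hcyc (hprodD H hidx)).1 hchar⟩
    · rintro ⟨hρH, hidx, hcrit⟩
      have hcyc := hcycOf D hD H hidx
      exact ⟨⟨hρH, hcyc, (forall_sum_char_eq_zero_iff_alternatingSum_of_index_two_mul_squarefree_fintype hne' hpD hinjD hoddD
        h hρH hcyc (hprodD H hidx)).2 hcrit⟩, by rw [hidx]; exact hnot4 D hD, hcls₂D D hD H hidx⟩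
  -- §B the fibres of the `4Π_D` half
  have hfib₄0 : (A.filter (fun H => 4 ∣ H.index)).filter (fun H => cls₄ H = ∅) = B₄ := by
    rw [hA, hB₄, Finset.filter_filter, Finset.filter_filter]
    refine Finset.filter_congr fun H _ => ?_
    constructor
    · rintro ⟨⟨hρH, hcyc, hchar⟩, h4, hc⟩
      have hidx : H.index = 4 := by
        have := ((index_eq_prod_primeFactors_of_exponent_four_mul hm hexp hρH hρ2 hcyc).2 h4).2
        rw [show (H.index / 4).primeFactors = ∅ from hc, Finset.prod_empty, mul_one] at this
        exact this
      exact ⟨hρH, hidx, hcyc, (forall_sum_char_eq_zero_iff_of_index_four h hρH hidx hcyc).1 hchar⟩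
    · rintro ⟨hρH, hidx, hcyc, hhalf⟩
      have hidx' : H.index = 4 * ∏ q ∈ (∅ : Finset ℕ), q := by rw [Finset.prod_empty, mul_one]; exact hidx
      exact ⟨⟨hρH, hcyc, (forall_sum_char_eq_zero_iff_of_index_four h hρH hidx hcyc).2 hhalf⟩, by rw [hidx],
        hcls₄D ∅ (Finset.empty_mem_powerset _) H hidx'⟩
  have hfib₄D : ∀ D ∈ m.primeFactors.powerset, D.Nonempty →
      (A.filter (fun H => 4 ∣ H.index)).filter (fun H => cls₄ H = D) =
        (Finset.univ : Finset (Subgroup G)).filter fun H => ρ ∉ H ∧ H.index = 4 * ∏ q ∈ D, q ∧ IsCyclic (G ⧸ H) ∧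
          ∀ (g : G) (x : D → G), (∀ q : D, x q ^ (q : ℕ) ∈ H) →
            ∑ ε : D → Bool, (∏ q, (if ε q then (-1 : ℤ) else 1)) *
              ((T.filter fun s => (g * ∏ q, (if ε q then x q else 1))⁻¹ * s ∈ H).card : ℤ) = 0 := by
    intro D hD hne
    have hne' : Nonempty D := hne.coe_sort
    have hpD : ∀ q : D, ((q : ℕ)).Prime := fun q => hDprime D hD q q.2
    have hoddD : ∀ q : D, (q : ℕ) ≠ 2 := fun q h2 => hodd (by
      have := Nat.dvd_of_mem_primeFactors (Finset.mem_powerset.1 hD q.2)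
      rwa [h2] at this)
    have hinjD : Function.Injective (fun q : D => (q : ℕ)) := Subtype.val_injective
    have hprodD : ∀ H : Subgroup G, H.index = 4 * ∏ q ∈ D, q → H.index = 4 * ∏ q : D, (q : ℕ) := fun H hidx => by
      rw [hidx, Finset.prod_coe_sort D (fun q => q)]
    rw [hA, Finset.filter_filter, Finset.filter_filter]
    refine Finset.filter_congr fun H _ => ?_
    constructor
    · rintro ⟨⟨hρH, hcyc, hchar⟩, h4, hc⟩
      have hidx : H.index = 4 * ∏ q ∈ D, q := by
        rw [← hc]; exact ((index_eq_prod_primeFactors_of_exponent_four_mul hm hexp hρH hρ2 hcyc).2 h4).2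
      exact ⟨hρH, hidx, hcyc, (forall_sum_char_eq_zero_iff_alternatingSum_of_index_four_mul_squarefree_fintype hne' hpD hinjD hoddD
        h hρH hcyc (hprodD H hidx)).1 hchar⟩
    · rintro ⟨hρH, hidx, hcyc, hcrit⟩
      exact ⟨⟨hρH, hcyc, (forall_sum_char_eq_zero_iff_alternatingSum_of_index_four_mul_squarefree_fintype hne' hpD hinjD hoddD
        h hρH hcyc (hprodD H hidx)).2 hcrit⟩, by rw [hidx]; exact dvd_mul_right 4 _, hcls₄D D hD H hidx⟩
  -- §C Euler's `φ` summed by classes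
  have hsum₂ : ∑ H ∈ A.filter (fun H => ¬ 4 ∣ H.index), H.index.totient =
      ∑ D ∈ m.primeFactors.powerset, (2 * ∏ q ∈ D, q).totient * ((A.filter (fun H => ¬ 4 ∣ H.index)).filter fun H => cls₂ H = D).card := by
    rw [← Finset.sum_fiberwise_of_maps_to hmaps₂]
    refine Finset.sum_congr rfl fun D _ => ?_
    have hconst : ∀ H ∈ (A.filter (fun H => ¬ 4 ∣ H.index)).filter (fun H => cls₂ H = D),
        H.index.totient = (2 * ∏ q ∈ D, q).totient := by
      intro H hH
      rw [Finset.mem_filter] at hH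
      rw [hidx₂ H hH.1, hH.2]
    rw [Finset.sum_congr rfl hconst, Finset.sum_const, smul_eq_mul, mul_comm]
  have hsum₄ : ∑ H ∈ A.filter (fun H => 4 ∣ H.index), H.index.totient =
      ∑ D ∈ m.primeFactors.powerset, (4 * ∏ q ∈ D, q).totient * ((A.filter (fun H => 4 ∣ H.index)).filter fun H => cls₄ H = D).card := by
    rw [← Finset.sum_fiberwise_of_maps_to hmaps₄]
    refine Finset.sum_congr rfl fun D _ => ?_
    have hconst : ∀ H ∈ (A.filter (fun H => 4 ∣ H.index)).filter (fun H => cls₄ H = D),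
        H.index.totient = (4 * ∏ q ∈ D, q).totient := by
      intro H hH
      rw [Finset.mem_filter] at hH
      rw [hidx₄ H hH.1, hH.2]
    rw [Finset.sum_congr rfl hconst, Finset.sum_const, smul_eq_mul, mul_comm]
  have hsplit₂ : ∑ D ∈ m.primeFactors.powerset, (2 * ∏ q ∈ D, q).totient * ((A.filter (fun H => ¬ 4 ∣ H.index)).filter fun H => cls₂ H = D).card =
      B₂.card + ∑ D ∈ m.primeFactors.powerset.filter (fun D => D.Nonempty),
        (2 * ∏ q ∈ D, q).totient * ((A.filter (fun H => ¬ 4 ∣ H.index)).filter fun H => cls₂ H = D).card := by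
    rw [Finset.sum_eq_add_sum_sdiff_singleton_of_mem (Finset.empty_mem_powerset _), Finset.prod_empty, mul_one, Nat.totient_two, one_mul,
      hfib₂0]
    congr 1
    refine Finset.sum_congr ?_ fun _ _ => rfl
    ext D
    simp only [Finset.mem_sdiff, Finset.mem_singleton, Finset.mem_filter, Finset.nonempty_iff_ne_empty]
  have h4tot : Nat.totient 4 = 2 := by decide
  have hsplit₄ : ∑ D ∈ m.primeFactors.powerset, (4 * ∏ q ∈ D, q).totient * ((A.filter (fun H => 4 ∣ H.index)).filter fun H => cls₄ H = D).card =
      2 * B₄.card + ∑ D ∈ m.primeFactors.powerset.filter (fun D => D.Nonempty),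
        (4 * ∏ q ∈ D, q).totient * ((A.filter (fun H => 4 ∣ H.index)).filter fun H => cls₄ H = D).card := by
    rw [Finset.sum_eq_add_sum_sdiff_singleton_of_mem (Finset.empty_mem_powerset _), Finset.prod_empty, mul_one, h4tot, hfib₄0]
    congr 1
    refine Finset.sum_congr ?_ fun _ _ => rfl
    ext D
    simp only [Finset.mem_sdiff, Finset.mem_singleton, Finset.mem_filter, Finset.nonempty_iff_ne_empty]
  have hsumD : ∑ D ∈ m.primeFactors.powerset.filter (fun D => D.Nonempty),
        (2 * ∏ q ∈ D, q).totient * ((A.filter (fun H => ¬ 4 ∣ H.index)).filter fun H => cls₂ H = D).card +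
      ∑ D ∈ m.primeFactors.powerset.filter (fun D => D.Nonempty),
        (4 * ∏ q ∈ D, q).totient * ((A.filter (fun H => 4 ∣ H.index)).filter fun H => cls₄ H = D).card =
      ∑ D ∈ m.primeFactors.powerset.filter (fun D => D.Nonempty),
        ((2 * ∏ q ∈ D, q).totient *
          ((Finset.univ : Finset (Subgroup G)).filter fun H => ρ ∉ H ∧ H.index = 2 * ∏ q ∈ D, q ∧
            ∀ (g : G) (x : D → G), (∀ q : D, x q ^ (q : ℕ) ∈ H) →
              ∑ ε : D → Bool, (∏ q, (if ε q then (-1 : ℤ) else 1)) *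
                ((T.filter fun s => (g * ∏ q, (if ε q then x q else 1))⁻¹ * s ∈ H).card : ℤ) = 0).card +
        (4 * ∏ q ∈ D, q).totient *
          ((Finset.univ : Finset (Subgroup G)).filter fun H => ρ ∉ H ∧ H.index = 4 * ∏ q ∈ D, q ∧ IsCyclic (G ⧸ H) ∧
            ∀ (g : G) (x : D → G), (∀ q : D, x q ^ (q : ℕ) ∈ H) →
              ∑ ε : D → Bool, (∏ q, (if ε q then (-1 : ℤ) else 1)) *
                ((T.filter fun s => (g * ∏ q, (if ε q then x q else 1))⁻¹ * s ∈ H).card : ℤ) = 0).card) := by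
    rw [← Finset.sum_add_distrib]
    refine Finset.sum_congr rfl fun D hD => ?_
    rw [hfib₂D D (Finset.mem_filter.1 hD).1 (Finset.mem_filter.1 hD).2, hfib₄D D (Finset.mem_filter.1 hD).1 (Finset.mem_filter.1 hD).2]
  have htotal : ∑ H ∈ A, H.index.totient =
      ∑ H ∈ A.filter (fun H => ¬ 4 ∣ H.index), H.index.totient + ∑ H ∈ A.filter (fun H => 4 ∣ H.index), H.index.totient := by
    rw [add_comm, Finset.sum_filter_add_sum_filter_not]
  omega

/-- **NONDEGENERACY CRITERION IN EXPONENT `4m`, `m` ODD SQUAREFREE** (any finite commutative `G` with `g^{4m} = 1`, CM type `T ∌`-involution `ρ`): `T` is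
NONDEGENERATE (`rank = |G|/2 + 1`) iff NO index-`2` subgroup `H ∌ ρ` splits `T` evenly, NO index-`4` subgroup `H ∌ ρ` with cyclic quotient meets every
coset in `|H|/2` elements of `T`, and for every nonempty set `D` of prime divisors of `m` NO subgroup `H ∌ ρ` of index `2Π_D q`, and NO subgroup `H ∌ ρ` of
index `4Π_D q` with cyclic quotient, has vanishing `|D|`-th mixed differences of the coset counts — every coefficient `φ(2Π_D q)`, `φ(4Π_D q)` of
`typeRank_add_card_kernels_eq_of_exponent_four_mul_squarefree` being positive. [cite: Kubota1965, §4 Lemma 2] [cite: Hazama2003CyclicCM, Prop. 4.3 and Thm. 4.8]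
[cite: Dodson1984, §3.1.1 Theorem] [cite: Yanai2015IndexDegeneracy, Thm. 4.1] -/
theorem typeRank_eq_iff_of_exponent_four_mul_squarefree (hm : Squarefree m) (hodd : ¬ 2 ∣ m)
    (h : IsCMTypeWith ρ (T : Set G)) (hexp : ∀ g : G, g ^ (4 * m) = 1) :
    typeRank G (T : Set G) = Fintype.card G / 2 + 1 ↔
      (∀ H : Subgroup G, ρ ∉ H → H.index = 2 → (T.filter fun s => s ∈ H).card ≠ (T.filter fun s => s ∉ H).card) ∧
      (∀ H : Subgroup G, ρ ∉ H → H.index = 4 → IsCyclic (G ⧸ H) → ¬ ∀ g : G, 2 * ((T.filter fun s => g⁻¹ * s ∈ H).card) = Nat.card H) ∧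
      (∀ D ∈ m.primeFactors.powerset, D.Nonempty → ∀ H : Subgroup G, ρ ∉ H → H.index = 2 * ∏ q ∈ D, q →
        ¬ ∀ (g : G) (x : D → G), (∀ q : D, x q ^ (q : ℕ) ∈ H) →
          ∑ ε : D → Bool, (∏ q, (if ε q then (-1 : ℤ) else 1)) *
            ((T.filter fun s => (g * ∏ q, (if ε q then x q else 1))⁻¹ * s ∈ H).card : ℤ) = 0) ∧
      (∀ D ∈ m.primeFactors.powerset, D.Nonempty → ∀ H : Subgroup G, ρ ∉ H → H.index = 4 * ∏ q ∈ D, q → IsCyclic (G ⧸ H) →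
        ¬ ∀ (g : G) (x : D → G), (∀ q : D, x q ^ (q : ℕ) ∈ H) →
          ∑ ε : D → Bool, (∏ q, (if ε q then (-1 : ℤ) else 1)) *
            ((T.filter fun s => (g * ∏ q, (if ε q then x q else 1))⁻¹ * s ∈ H).card : ℤ) = 0) := by
  have key := typeRank_add_card_kernels_eq_of_exponent_four_mul_squarefree hm hodd h hexp
  set b₂ := ((Finset.univ : Finset (Subgroup G)).filter fun H => ρ ∉ H ∧ H.index = 2 ∧
        (T.filter fun s => s ∈ H).card = (T.filter fun s => s ∉ H).card).card with hb₂
  set b₄ := ((Finset.univ : Finset (Subgroup G)).filter fun H : Subgroup G => ρ ∉ H ∧ H.index = 4 ∧ IsCyclic (G ⧸ H) ∧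
        ∀ g : G, 2 * ((T.filter fun s => g⁻¹ * s ∈ H).card) = Nat.card H).card with hb₄
  set c₂ : Finset ℕ → ℕ := fun D =>
          ((Finset.univ : Finset (Subgroup G)).filter fun H => ρ ∉ H ∧ H.index = 2 * ∏ q ∈ D, q ∧
            ∀ (g : G) (x : D → G), (∀ q : D, x q ^ (q : ℕ) ∈ H) →
              ∑ ε : D → Bool, (∏ q, (if ε q then (-1 : ℤ) else 1)) *
                ((T.filter fun s => (g * ∏ q, (if ε q then x q else 1))⁻¹ * s ∈ H).card : ℤ) = 0).card with hc₂
  set c₄ : Finset ℕ → ℕ := fun D =>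
          ((Finset.univ : Finset (Subgroup G)).filter fun H => ρ ∉ H ∧ H.index = 4 * ∏ q ∈ D, q ∧ IsCyclic (G ⧸ H) ∧
            ∀ (g : G) (x : D → G), (∀ q : D, x q ^ (q : ℕ) ∈ H) →
              ∑ ε : D → Bool, (∏ q, (if ε q then (-1 : ℤ) else 1)) *
                ((T.filter fun s => (g * ∏ q, (if ε q then x q else 1))⁻¹ * s ∈ H).card : ℤ) = 0).card with hc₄
  have key' : typeRank G (T : Set G) + (b₂ + 2 * b₄ + ∑ D ∈ m.primeFactors.powerset.filter (fun D => D.Nonempty),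
      ((2 * ∏ q ∈ D, q).totient * c₂ D + (4 * ∏ q ∈ D, q).totient * c₄ D)) = Fintype.card G / 2 + 1 := by
    rw [← key]; ring
  have hiff : typeRank G (T : Set G) = Fintype.card G / 2 + 1 ↔
      b₂ = 0 ∧ b₄ = 0 ∧ ∀ D ∈ m.primeFactors.powerset.filter (fun D => D.Nonempty),
        (2 * ∏ q ∈ D, q).totient * c₂ D + (4 * ∏ q ∈ D, q).totient * c₄ D = 0 := by
    rw [← Finset.sum_eq_zero_iff]
    constructor
    · intro hr
      rw [hr] at key'
      refine ⟨by omega, by omega, by omega⟩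
    · rintro ⟨h0, h1, h2⟩
      rw [h0, h1, h2, mul_zero, add_zero, add_zero, add_zero] at key'
      exact key'
  have hpos : ∀ D ∈ m.primeFactors.powerset, ∀ e : ℕ, 0 < e → 0 < (e * ∏ q ∈ D, q).totient := fun D hD e he =>
    Nat.totient_pos.2 (Nat.mul_pos he (Finset.prod_pos fun q hq => (Nat.prime_of_mem_primeFactors (Finset.mem_powerset.1 hD hq)).pos))
  have hterm : ∀ D ∈ m.primeFactors.powerset,
      ((2 * ∏ q ∈ D, q).totient * c₂ D + (4 * ∏ q ∈ D, q).totient * c₄ D = 0 ↔ c₂ D = 0 ∧ c₄ D = 0) := by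
    intro D hD
    have h2 := hpos D hD 2 two_pos
    have h4 := hpos D hD 4 four_pos
    constructor
    · intro h0
      have h0' := Nat.eq_zero_of_add_eq_zero h0
      exact ⟨(Nat.mul_eq_zero.1 h0'.1).resolve_left h2.ne', (Nat.mul_eq_zero.1 h0'.2).resolve_left h4.ne'⟩
    · rintro ⟨h0, h1⟩
      rw [h0, h1, mul_zero, mul_zero, add_zero]
  rw [hiff]
  -- read each vanishing as an emptiness statement
  have hb₂iff : b₂ = 0 ↔ ∀ H : Subgroup G, ρ ∉ H → H.index = 2 →
      (T.filter fun s => s ∈ H).card ≠ (T.filter fun s => s ∉ H).card := by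
    rw [hb₂, Finset.card_eq_zero, Finset.filter_eq_empty_iff]
    constructor
    · intro hno H hρH hidx heq
      exact hno (Finset.mem_univ H) ⟨hρH, hidx, heq⟩
    · rintro hno H - ⟨hρH, hidx, heq⟩
      exact hno H hρH hidx heq
  have hb₄iff : b₄ = 0 ↔ ∀ H : Subgroup G, ρ ∉ H → H.index = 4 → IsCyclic (G ⧸ H) →
      ¬ ∀ g : G, 2 * ((T.filter fun s => g⁻¹ * s ∈ H).card) = Nat.card H := by
    rw [hb₄, Finset.card_eq_zero, Finset.filter_eq_empty_iff]
    constructor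
    · intro hno H hρH hidx hcyc hhalf
      exact hno (Finset.mem_univ H) ⟨hρH, hidx, hcyc, hhalf⟩
    · rintro hno H - ⟨hρH, hidx, hcyc, hhalf⟩
      exact hno H hρH hidx hcyc hhalf
  have hc₂iff : ∀ D, c₂ D = 0 ↔ ∀ H : Subgroup G, ρ ∉ H → H.index = 2 * ∏ q ∈ D, q →
      ¬ ∀ (g : G) (x : D → G), (∀ q : D, x q ^ (q : ℕ) ∈ H) →
        ∑ ε : D → Bool, (∏ q, (if ε q then (-1 : ℤ) else 1)) *
          ((T.filter fun s => (g * ∏ q, (if ε q then x q else 1))⁻¹ * s ∈ H).card : ℤ) = 0 := by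
    intro D
    rw [hc₂]
    dsimp only
    rw [Finset.card_eq_zero, Finset.filter_eq_empty_iff]
    constructor
    · intro hno H hρH hidx hcrit
      exact hno (Finset.mem_univ H) ⟨hρH, hidx, hcrit⟩
    · rintro hno H - ⟨hρH, hidx, hcrit⟩
      exact hno H hρH hidx hcrit
  have hc₄iff : ∀ D, c₄ D = 0 ↔ ∀ H : Subgroup G, ρ ∉ H → H.index = 4 * ∏ q ∈ D, q → IsCyclic (G ⧸ H) →
      ¬ ∀ (g : G) (x : D → G), (∀ q : D, x q ^ (q : ℕ) ∈ H) →
        ∑ ε : D → Bool, (∏ q, (if ε q then (-1 : ℤ) else 1)) *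
          ((T.filter fun s => (g * ∏ q, (if ε q then x q else 1))⁻¹ * s ∈ H).card : ℤ) = 0 := by
    intro D
    rw [hc₄]
    dsimp only
    rw [Finset.card_eq_zero, Finset.filter_eq_empty_iff]
    constructor
    · intro hno H hρH hidx hcyc hcrit
      exact hno (Finset.mem_univ H) ⟨hρH, hidx, hcyc, hcrit⟩
    · rintro hno H - ⟨hρH, hidx, hcyc, hcrit⟩
      exact hno H hρH hidx hcyc hcrit
  rw [hb₂iff, hb₄iff]
  refine and_congr_right fun _ => and_congr_right fun _ => ?_
  constructor
  · intro hno
    refine ⟨fun D hD hne => ?_, fun D hD hne => ?_⟩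
    · exact (hc₂iff D).1 ((hterm D hD).1 (hno D (Finset.mem_filter.2 ⟨hD, hne⟩))).1
    · exact (hc₄iff D).1 ((hterm D hD).1 (hno D (Finset.mem_filter.2 ⟨hD, hne⟩))).2
  · rintro ⟨hno₂, hno₄⟩ D hD
    rw [Finset.mem_filter] at hD
    exact (hterm D hD.1).2 ⟨(hc₂iff D).2 (hno₂ D hD.1 hD.2), (hc₄iff D).2 (hno₄ D hD.1 hD.2)⟩

end ExponentFourSquarefree

end AbelianKernels

end CyclicCMType

end Literature.NumberTheory.ComplexMultiplication

end
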